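import Summits.BirchSwinnertonDyer.BirchSwinnertonDyer.Theses.GenusKolyvaginAtTwo
import Summits.BirchSwinnertonDyer.BirchSwinnertonDyer.Theorems.GenusKolyvaginAtTwoPubInputsAtTwoDefs
import Summits.BirchSwinnertonDyer.BirchSwinnertonDyer.Theorems.GenusKolyvaginAtTwoPowDvdShaCardAtTwoRTFixedPartCyclicHolds
import Summits.BirchSwinnertonDyer.BirchSwinnertonDyer.Theorems.GenusKolyvaginAtTwoPowDvdShaCardAtTwoRTTwinShaLaddersOfProp52Div
import HarnessLib

/-!
# LINE 18 `plus_descent` — stub L RESHAPE CANDIDATE (v5.2, gk2-p2 g18): `stub_twinShaLaddersAtTwo` ⟸ `stub_prop52DivAtTwo`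

Crux workfile (not a Theorems file; the one `sorry` is the proposed new stub).  With the descent/supply layer landed
(`Theorems/…RTTwinShaLaddersOfProp52Div`, `twinShaLadders_of_prop52DivAtTwo`, and the 17 files under it), stub L of the registered
skeleton `Lines/plus_descent.lean` is DERIVED below (`stub_twinShaLaddersAtTwo_derived`, same signature byte for byte) from ONE
smaller stub on the SAME binders, `stub_prop52DivAtTwo` = McCallum's Prop. 5.2 at `2` in Kolyvagin's DIVISIBILITY currency:
for the non-trivial `τ ∈ Aut(K/ℚ)`, when `M₀ ≥ 1`: `∃ L ≥ M₀+1, R ≥ 1, k` with `k R = L` and, for `1 ≤ r ≤ R`, writing `M_r := L − k r`: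
`k r ≤ L`; the LOWER BOUND `2^{M_r} ∣ P_d(n′)` for every deep square-free depth-`r` level `n′` (all primes Kolyvagin of index `≥ L`) and
every datum; and, when `M_r < L`, the AVOIDANCE — for every `≤ r`-generated subgroup `⟨u⟩ ⊂ Sel_{2^L}(E/K)^{ε_r}`, `ε_r = −w(E)(−1)^r`,
a deep depth-`r` `(n, d)` with `2^{M_r+1} ∤ P_d(n)` and `⟨c_L(n)⟩ ∩ ⟨u⟩ = 0`; at `r = R` (`M_R = 0`) this is a deep level with `2 ∤ P(n)`
— the BOTTOM RUNG, i.e. L's shallow witness `hPn` moved to deep primes by the prime-swapping loop (S-bot engine).  No class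
orders / ladder / annihilation are asked: the order formula and Cor. 4.5 are applied inside `…RTTwinShaLaddersOfProp52Div` (McCallum Prop. 5.2 verbatim: «`C ⊂ S_∞(E/K)^{ε_r}` of rank `r`, `M > M_r` ⟹ `∃ n ∈ S_r(M)`, `c_M(n)` of order
`p^{M−M_r}`, `⟨c_M(n)⟩ ∩ C = 0`»).  LEAD: to adopt, replace stub L's `sorry` by the body of `stub_twinShaLaddersAtTwo_derived` and
register `stub_prop52DivAtTwo` (stubs L → P52÷; Deep, P unchanged; composition unchanged).
-/

set_option linter.dupNamespace false
set_option autoImplicit false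

noncomputable section

namespace Summit.BirchSwinnertonDyer.BirchSwinnertonDyer.Cruxes.PowDvdShaCardAtTwoRT.PlusDescent.LReshape

open scoped Classical
open WeierstrassCurve NumberField IsDedekindDomain Field
open Literature.NumberTheory.GaloisRepresentations Literature.NumberTheory.EllipticCurves
open Literature.NumberTheory Literature.NumberTheory.EllipticCurves.ModularForms
open Summit.BirchSwinnertonDyer.BirchSwinnertonDyer.Theses.GenusKolyvaginAtTwo
open Summit.BirchSwinnertonDyer.BirchSwinnertonDyer.Theorems.GenusExact.PlusDescent (PubInputsAtTwo twinShaLadders_of_prop52DivAtTwo)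

/-- Copy (verbatim) of the skeleton's `CyclicFixedPartOfNegDisc` (`Lines/plus_descent.lean`, where it is a local `def`), so that this
workfile elaborates standalone; inside the skeleton the original is in scope. [cite: McCallumLMS1991, Lemma 5.3] [cite: GrossLMS1991, (3.3)] -/
def CyclicFixedPartOfNegDisc : Prop :=
  ∀ (W : WeierstrassCurve ℚ) [W.IsElliptic], W.Δ < 0 → ∀ (c₀ : Field.absoluteGaloisGroup ℚ), Literature.NumberTheory.GaloisRepresentations.IsComplexConjugation (Rat.castHom ℝ) c₀ → ∀ (M : ℕ), ∃ P : W.geomTorsion ((2 ^ M : ℕ) : ℤ), addOrderOf P = 2 ^ M ∧ ∀ Q : W.geomTorsion ((2 ^ M : ℕ) : ℤ), c₀ • Q = Q ↔ Q ∈ AddSubgroup.zmultiples P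

/-- **stub P52÷ `stub_prop52DivAtTwo` (proposed, v5.2)** — McCallum's Prop. 5.2 at `2` in Kolyvagin's divisibility currency (level `L`,
deep levels, both signs, lower bound `2^{M_r} ∣ P(n′)`, witnesses `2^{M_r} ∥ P(n)` avoiding `⟨u⟩`, bottom rung `2 ∤ P(n)`), on stub L's
binders; asked only when `M₀ ≥ 1`.  This is the engines' deliverable: the S-bot (`k R = L`: L's shallow `hPn` moved to deep primes) and,
per depth, McCallum's prime-swapping loop — in the tree as `exists_level_avoiding_of_weakSwapOracle_pow` (`…RTPrimeSwappingWeakLevel`,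
p711486: instantiate `cls S := c_L(∏S)`, `Inv S ∋ «S ⊆ S(L), #S = r, 2^{M_r} ∥ P_{∏S}»`, `A l :=` the strict local condition at `λ_l`,
`good l :=` «`l` deep Kolyvagin, `φ_{Frob λ_L}`-behaviour», weak ORACLE := one swap `l₀ ↦ l′`) — whose oracle is where the arithmetic
lives: Q5R `EquivariantChebotarevAtTwoR` (binder `hQ5R`) for the Čebotarev prime `l′` realising the TWO non-vanishings
(`c_{M_r+1}(n)_{λ′} ≠ 0`, `c_{aux,λ′} ≠ 0`; two non-zero vectors of an `𝔽₂`-space admit a common non-vanishing functional, so McCallum's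
third prescription `ψ` is not needed — g16), the auxiliary class of Prop. 2.1 / Lemma 5.3 (`GenusExact.AuxiliaryClass.exists_ne_zero_selmerLocalKer`),
Q2 `KolyvaginRelationAtTwo` (binder `hQ2`, Prop. 4.4 both directions) to move `2^{M_r} ∥ P` across the swap (Prop. 4.7), the reciprocity
sum (13) `sum_inv_weilCupProduct_localization_eq_zero`, and the cyclic fixed parts `CyclicFixedPartOfNegDisc` (binder `hCF`, Lemma 5.3
duality over `ℚ_l` at 2 = `lemma_5_3_rat_two`).
Why it might fail (at `p = 2` specifically): (I7) ISOTROPY of `im χ_l ⊂ H¹(K_λ, E[2^M])` — McCallum's proof («the cup product is skew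
symmetric and `Gal(K/ℚ)`-equivariant, so it vanishes on `im χ_l`») gives only skew-symmetry, which at 2 is not alternation: one bit per
own prime `l ∈ S ∖ l₀` may leak into the sum (13), and then the swap no longer certifies `c_{M_r+1}(nl′)_{λ₀} ≠ 0` (gk2-p3
`…RTTransverseIsotropic`, open); the «different eigenspace» separation `C × ⟨c_{M_r+1}(n)⟩ ∩ ⟨c⟩ = 0` is void at 2 (`+1 = −1` on
`E[2]`) and must be replaced by the socle/weak-oracle bookkeeping (done in `…RTPrimeSwappingWeak`, but only for the loop, not for
the choice (12) `φ(c) ≠ 0`); and the K-side ambient needs `[C[2] : C[2] ∩ A_l] ∣ 2`, which holds side-wise over `ℚ` (`Δ < 0`,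
cyclic fixed part) but FAILS over `K` for mixed-sign `C` — (P52÷) only ever asks it for `C ⊂ Sel^{ε_r}` of ONE sign, where
`Frob_λ = τ` acts as the scalar `ε_r` and the `ℚ`-side cyclicity applies.
[cite: McCallumLMS1991, §5 Prop. 5.2 (proof pp. 308–310), Lemma 5.3, Thm. 5.4; §4 Prop. 4.4, Prop. 4.7] [cite: GrossLMS1991, Prop. 3.7, Prop. 4.4] -/
theorem stub_prop52DivAtTwo :
    PubInputsAtTwo → KolyvaginRelationAtTwo → EquivariantChebotarevAtTwoR → CyclicFixedPartOfNegDisc → ∀ (W : WeierstrassCurve ℚ) [W.IsElliptic] [W.IsGloballyMinimal] [NeZero (W.conductorNorm ℤ)], ¬ W.HasCM → Odd W.tamagawaProduct → W.Δ < 0 → ∀ (K : Type) [Field K] [NumberField K], Literature.NumberTheory.EllipticCurves.IsImaginaryQuadratic K → Odd (NumberField.discr K) → NumberField.discr K ≠ -3 → Literature.NumberTheory.EllipticCurves.SatisfiesHeegnerHypothesis (W.conductorNorm ℤ) K → ¬ IsSquare ((NumberField.discr K : ℚ) * -|W.Δ|) → ¬ IsSquare ((NumberField.discr K : ℚ) *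 (-(2 * |W.Δ|))) → (∀ n : ℕ, 0 < n → W.HasSurjectiveModNGaloisRep ((2 : ℤ) ^ n)) → ∀ (Dt : Literature.NumberTheory.EllipticCurves.ModularForms.ModularParametrizationData W (W.conductorNorm ℤ)) (β : ℤ) (ι : K →+* ℂ) (d₁ : Literature.NumberTheory.EllipticCurves.KolyvaginHeegnerData Dt β ι 1), ¬ IsOfFinAddOrder d₁.derivedPoint → ∀ (M₀ : ℕ), (∃ Q : (W.baseChange (Literature.NumberTheory.EllipticCurves.ringClassField K ι 1)).toAffine.Point, ((2 ^ M₀ : ℕ) : ℤ) • Q = d₁.derivedPoint) → (¬ ∃ Q : (W.baseChange (Literature.NumberTheory.EllipticCurves.ringClassField K ι 1)).toAffine.Point, ((2 ^ (M₀ + 1) : ℕ) : ℤ) • Q = d₁.derivedPoint) → ∀ (n : ℕ) (d : Literature.NumberTheory.EllipticCurves.KolyvaginHeegnerData Dt β ι n), Squarefree n → (∀ ℓ ∈ n.primeFactors, Literature.NumberTheory.EllipticCurves.Zhang2014.IsKolyvaginPrime (W.conductorNorm ℤ) W K 2 ℓ) → (¬ ∃ Q : (W.baseChange (Literature.NumberTheory.EllipticCurves.ringClassField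 K ι n)).toAffine.Point, (2 : ℤ) • Q = d.derivedPoint) → ∀ (Wd : WeierstrassCurve ℚ) [Wd.IsElliptic] [Wd.IsGloballyMinimal], (∃ C : WeierstrassCurve.VariableChange ℚ, C • W.quadraticTwist (NumberField.discr K : ℚ) = Wd) → 0 < M₀ → ∀ τ : K ≃ₐ[ℚ] K, τ ≠ 1 → ∃ (L R : ℕ) (k : ℕ → ℕ), M₀ + 1 ≤ L ∧ 1 ≤ R ∧ k R = L ∧
      ∀ r : ℕ, 1 ≤ r → r ≤ R →
        k r ≤ L ∧
        (∀ (n : ℕ) (d : KolyvaginHeegnerData Dt β ι n), Squarefree n →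
          (∀ ℓ ∈ n.primeFactors, Zhang2014.IsKolyvaginPrime (W.conductorNorm ℤ) W K 2 ℓ ∧ L ≤ Zhang2014.kolyvaginIndex W 2 ℓ) →
          n.primeFactors.card = r →
          ∃ B : (W.baseChange (ringClassField K ι n)).toAffine.Point, ((2 ^ (L - k r) : ℕ) : ℤ) • B = d.derivedPoint) ∧
        (0 < k r → ∀ (i : ℕ) (u : Fin i → galH1Torsion (W.baseChange K) ((2 ^ L : ℕ) : ℤ)), i ≤ r →
          (∀ j, u j ∈ selmerGroup (W.baseChange K) ((2 ^ L : ℕ) : ℤ) ∧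
            conjAct W τ ((2 ^ L : ℕ) : ℤ) (u j) = (-W.rootNumber * (-1) ^ r) • u j) →
          ∃ (n : ℕ) (_ : Squarefree n)
            (_ : ∀ ℓ ∈ n.primeFactors, Zhang2014.IsKolyvaginPrime (W.conductorNorm ℤ) W K 2 ℓ ∧ L ≤ Zhang2014.kolyvaginIndex W 2 ℓ)
            (_ : n.primeFactors.card = r) (d : KolyvaginHeegnerData Dt β ι n),
            (¬ ∃ B : (W.baseChange (ringClassField K ι n)).toAffine.Point, ((2 ^ (L - k r + 1) : ℕ) : ℤ) • B = d.derivedPoint) ∧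
            Disjoint (AddSubgroup.zmultiples (d.kolyvaginClass Nat.prime_two L)) (AddSubgroup.closure (Set.range u))) := by
  sorry

/-- **stub L DERIVED from stub P52÷** (same signature as the registered `stub_twinShaLaddersAtTwo`, byte for byte), by
`GenusExact.PlusDescent.twinShaLadders_of_prop52DivAtTwo` (`Theorems/…RTTwinShaLaddersOfProp52Div`). [cite: McCallumLMS1991, §5 Prop. 5.2, Thm. 5.4] -/
theorem stub_twinShaLaddersAtTwo_derived :
    PubInputsAtTwo → KolyvaginRelationAtTwo → EquivariantChebotarevAtTwoR → CyclicFixedPartOfNegDisc → ∀ (W : WeierstrassCurve ℚ) [W.IsElliptic] [W.IsGloballyMinimal] [NeZero (W.conductorNorm ℤ)], ¬ W.HasCM → Odd W.tamagawaProduct → W.Δ < 0 → ∀ (K : Type) [Field K] [NumberField K], Literature.NumberTheory.EllipticCurves.IsImaginaryQuadratic K → Odd (NumberField.discr K) → NumberField.discr K ≠ -3 → Literature.NumberTheory.EllipticCurves.SatisfiesHeegnerHypothesis (W.conductorNorm ℤ) K → ¬ IsSquare ((NumberField.discr K : ℚ) * -|W.Δ|) → ¬ IsSquare ((NumberField.discr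 K : ℚ) * (-(2 * |W.Δ|))) → (∀ n : ℕ, 0 < n → W.HasSurjectiveModNGaloisRep ((2 : ℤ) ^ n)) → ∀ (Dt : Literature.NumberTheory.EllipticCurves.ModularForms.ModularParametrizationData W (W.conductorNorm ℤ)) (β : ℤ) (ι : K →+* ℂ) (d₁ : Literature.NumberTheory.EllipticCurves.KolyvaginHeegnerData Dt β ι 1), ¬ IsOfFinAddOrder d₁.derivedPoint → ∀ (M₀ : ℕ), (∃ Q : (W.baseChange (Literature.NumberTheory.EllipticCurves.ringClassField K ι 1)).toAffine.Point, ((2 ^ M₀ : ℕ) : ℤ) • Q = d₁.derivedPoint) → (¬ ∃ Q : (W.baseChange (Literature.NumberTheory.EllipticCurves.ringClassField K ι 1)).toAffine.Point, ((2 ^ (M₀ + 1) : ℕ) : ℤ) • Q = d₁.derivedPoint) → ∀ (n : ℕ) (d : Literature.NumberTheory.EllipticCurves.KolyvaginHeegnerData Dt β ι n), Squarefree n → (∀ ℓ ∈ n.primeFactors, Literature.NumberTheory.EllipticCurves.Zhang2014.IsKolyvaginPrime (W.conductorNorm ℤ) W K 2 ℓ) → (¬ ∃ Q : (W.baseChange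 (Literature.NumberTheory.EllipticCurves.ringClassField K ι n)).toAffine.Point, (2 : ℤ) • Q = d.derivedPoint) → ∀ (Wd : WeierstrassCurve ℚ) [Wd.IsElliptic] [Wd.IsGloballyMinimal], (∃ C : WeierstrassCurve.VariableChange ℚ, C • W.quadraticTwist (NumberField.discr K : ℚ) = Wd) → ∃ (T : ℕ) (M : ℕ → ℕ), (∀ j, M (j + 1) ≤ M j) ∧ M 0 = M₀ ∧ M (2 * T) = 0 ∧ (∀ m < T, ∃ x : Fin (2 * m + 2) → W.galH1, (∀ i, resBaseChange W K (x i) ∈ (W.baseChange K).sha) ∧ (∀ i, addOrderOf (x i) = 2 ^ (M (2 * m) - M (2 * m + 1))) ∧ ∀ c : Fin (2 * m + 2) → ℤ, ∑ i, c i • x i = 0 → ∀ i, ((2 ^ (M (2 * m) - M (2 * m + 1)) : ℕ) : ℤ) ∣ c i) ∧ (∀ m < T, ∃ x : Fin (2 * m + 2) → Wd.galH1, (∀ i, resBaseChange Wd K (x i) ∈ (Wd.baseChange K).sha) ∧ (∀ i, addOrderOf (x i) = 2 ^ (M (2 * m + 1) - M (2 * m + 2))) ∧ ∀ c : Fin (2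 * m + 2) → ℤ, ∑ i, c i • x i = 0 → ∀ i, ((2 ^ (M (2 * m + 1) - M (2 * m + 2)) : ℕ) : ℤ) ∣ c i) := by
  intro hP hQ2 hQ5R hCF W _ _ _ hcm hT hneg K _ _ hIQ hodd h3 hHe hsq1 hsq2 hρ Dt β ι d₁ hy M₀ hdiv hndiv n d hn hKoly hPn Wd _ _ hTw
  exact twinShaLadders_of_prop52DivAtTwo hP hQ2 W hcm hT K hIQ hodd h3 hHe hρ Dt β ι d₁ hy M₀ hdiv hndiv Wd hTw
    (stub_prop52DivAtTwo hP hQ2 hQ5R hCF W hcm hT hneg K hIQ hodd h3 hHe hsq1 hsq2 hρ Dt β ι d₁ hy M₀ hdiv hndiv n d hn hKoly hPn Wd hTw)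

end Summit.BirchSwinnertonDyer.BirchSwinnertonDyer.Cruxes.PowDvdShaCardAtTwoRT.PlusDescent.LReshape

end
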